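import Literature.AlgebraicGeometry.Frobenioids.ModelFrobenioidRootFunctors
import Literature.AlgebraicGeometry.Frobenioids.PerfectionOps
import HarnessLib

/-!
# Frobenioids I, Prop. 5.5 (iv), `C^pf` clause: the comparison functor `C^pf ⥤ C'` from THE perfection of a
# model Frobenioid to the model Frobenioid of the perfected data — construction, faithfulness, essential
# surjectivity, compatibility with `Base`

Mochizuki, *The geometry of Frobenioids I: the general theory*, Kyushu J. Math. **62** (2008) 293–400, §5,
Proposition 5.5 (iv), kurims p. 104 ll. 40–43, proof p. 105 ll. 26–27 ("follows immediately from the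
definitions") [cite: MochizukiFrdI2008, Prop. 5.5 (iv) p.104]; the perfection `C^pf` of Def. 3.1 (iii) p. 57
(abc-iut-L1-d9's `PreFrobenioid.Perfection`: objects `(A, n)` = "`n`-th roots", morphisms = perfected morphisms,
classes of representatives `A^{(a)} → B^{(b)}` at levels `n a = m b`).

For `C` the model Frobenioid of `(Φ, B, Div_B)` under the standing hypotheses of Thm. 5.2
(`ModelFrobenioid.Hypotheses`) and perfected data `Div_B^pf` (`IsPerfectedDiv`), cell abc-iut L1 sub-DAG row
P55-L08 (slot `FrdI.Prop55Sub.Prop55iv_pf`), seat abc-iut-w5-d120: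

* `pfObj X = (A_D, ι(α)^{1/n})` for `X = ((A_D, α), n)`;
* `repMap r` for a representative `θ : A^{(a)} → B^{(b)}` at level `(a, b)`, `N = n a = m b`:
  `rootLift(frob_A a) ≫ rootMap N θ ≫ rootLift(frob_B b)⁻¹ : pfObj (A, n) → pfObj (B, m)` — in words: read `θ`
  in the perfected model after extracting `N`-th roots and conjugate by the isomorphisms that the chosen
  Frobenius arrows `A → A^{(a)}`, `B → B^{(b)}` become there (`ModelFrobenioidRootFunctors`);
* `repMap_lift` — independence of the level (transport along the transition arrows of Frobenius type), whence
  `pfFunctor : C^pf ⥤ C'` (`pfFunctor_map_mk`), a functor (composition at a common triple level);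
* `pfFunctor_faithful` — two representatives with the same image differ by torsion in `Div` and `u`, which a
  further Frobenius conjugation kills; `pfFunctor_essSurj` — every `(A_D, γ)` of `C'` is `pfObj ((A_D, c), N)`
  (`γ = ι_N^gp(c)`); `pfFunctorCompBaseIso` — `pfFunctor ⋙ Base = Base` of `C^pf` (abc-iut-L1-d9's `Perfection.ops`).
Fullness and the slot theorem are in `Prop55ivPfProofs.lean`. No statement of the paper is strengthened; nothing
here bears on [IUTchIII] or asserts anything about abc.
-/

noncomputable section

namespace Literature.AlgebraicGeometry.Frobenioids

open CategoryTheory Opposite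

universe w v u

namespace ModelFrobenioid

namespace PfCompare

variable {D : Type u} [Category.{v} D] {Φ B : Dᵒᵖ ⥤ CommMonCat.{w}} {DivB : B ⟶ monoidGp Φ}
  {DivBpf : perfectionFunctor B ⟶ monoidGp (perfectionFunctor Φ)}

/-! ### The standing hypotheses in the forms used -/

/-- `Φ` divisorial ⟹ `Φ(A)` integral (cancellative). [cite: MochizukiFrdI2008, Thm. 5.2 p.100] -/
theorem isCancelMul_of (h : Hypotheses Φ B) (A : Dᵒᵖ) : IsCancelMul (Φ.obj A) :=
  isIntegral_iff_isCancelMul.mp (h.isDivisorial (unop A)).isPreDivisorial.isIntegral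

/-- `B` group-like ⟹ every element of `B(A)` is a unit. [cite: MochizukiFrdI2008, Thm. 5.2 p.100] -/
theorem isUnit_of (h : Hypotheses Φ B) (A : Dᵒᵖ) (b : B.obj A) : IsUnit b :=
  (h.isGroupLike_rat (unop A)).isUnit b

variable (h : Hypotheses Φ B) (hpf : IsPerfectedDiv Φ B DivB DivBpf)

/-- THE perfection `C^pf` of the model Frobenioid `C` of `(Φ, B, Div_B)` (abc-iut-L1-d9's `Perfection` at
abc-iut-found's Thm. 5.2 (ii)). [cite: MochizukiFrdI2008, Def. 3.1 (iii) p.57] -/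
abbrev Pf (DivB : B ⟶ monoidGp Φ) : Type (max u w) := PreFrobenioid.Perfection (h.isFrobenioid Φ B DivB)

variable (DivBpf) in
/-- **The comparison on objects**: `((A_D, α), n) ↦ (A_D, ι(α)^{1/n})` ("`(A, n)` is an `n`-th root of `A`").
[cite: MochizukiFrdI2008, Prop. 5.5 (iv) p.104] -/
abbrev pfObj (X : Pf h DivB) : ModelFrobenioid (perfectionFunctor Φ) (perfectionFunctor B) DivBpf :=
  rootObj DivBpf X.idx X.obj

/-- The isomorphism `pfObj (A, n) ≅ rootObj N A^{(a)}` (`N = n a`) that the chosen Frobenius arrow `A → A^{(a)}`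
becomes in `C'` (`rootLift`, an isomorphism by `isIso_rootLift`). [cite: MochizukiFrdI2008, Prop. 5.5 (iv) p.104] -/
def RLiso (X : Pf h DivB) (a N : ℕ+) (hN : X.idx * a = N) :
    pfObj DivBpf h X ≅ rootObj DivBpf N (PreFrobenioid.frobPow (h.isFrobenioid Φ B DivB) X.obj a) :=
  haveI := isIso_rootLift (hΦc := isCancelMul_of h) (hpf := hpf) (isUnit_of h)
    (PreFrobenioid.frob (h.isFrobenioid Φ B DivB) X.obj a)
    (PreFrobenioid.isFrobeniusType_frob (h.isFrobenioid Φ B DivB) X.obj a) X.idx a N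
    (PreFrobenioid.degFr_frob (h.isFrobenioid Φ B DivB) X.obj a) hN
  asIso (rootLift (isCancelMul_of h) hpf (PreFrobenioid.frob (h.isFrobenioid Φ B DivB) X.obj a)
    (PreFrobenioid.isFrobeniusType_frob (h.isFrobenioid Φ B DivB) X.obj a) X.idx a N
    (PreFrobenioid.degFr_frob (h.isFrobenioid Φ B DivB) X.obj a) hN)

/-- `RLiso` is `rootLift` of the chosen Frobenius arrow. [cite: MochizukiFrdI2008, Prop. 5.5 (iv) p.104] -/
theorem RLiso_hom (X : Pf h DivB) (a N : ℕ+) (hN : X.idx * a = N) :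
    (RLiso h hpf X a N hN).hom = rootLift (isCancelMul_of h) hpf (PreFrobenioid.frob (h.isFrobenioid Φ B DivB) X.obj a)
      (PreFrobenioid.isFrobeniusType_frob (h.isFrobenioid Φ B DivB) X.obj a) X.idx a N
      (PreFrobenioid.degFr_frob (h.isFrobenioid Φ B DivB) X.obj a) hN := rfl

/-! ### The comparison on representatives -/

/-- The image of a representative `θ : A^{(a)} → B^{(b)}` (level `(a, b)`, `N = n a = m b`):
`rootLift(frob_A) ≫ rootMap N θ ≫ rootLift(frob_B)⁻¹`. [cite: MochizukiFrdI2008, Prop. 5.5 (iv) p.104] -/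
def repMapAt {X Y : Pf h DivB} (r : PreFrobenioid.Perfection.Rep X Y) (N : ℕ+) (hX : X.idx * r.L.a = N)
    (hY : Y.idx * r.L.b = N) : pfObj DivBpf h X ⟶ pfObj DivBpf h Y :=
  (RLiso h hpf X r.L.a N hX).hom ≫ rootMap (isCancelMul_of h) hpf N r.hom ≫ (RLiso h hpf Y r.L.b N hY).inv

/-- The image of a representative, at its own `N = n a`. [cite: MochizukiFrdI2008, Prop. 5.5 (iv) p.104] -/
def repMap {X Y : Pf h DivB} (r : PreFrobenioid.Perfection.Rep X Y) : pfObj DivBpf h X ⟶ pfObj DivBpf h Y :=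
  repMapAt h hpf r (X.idx * r.L.a) rfl r.L.eq.symm

/-- `repMapAt` does not depend on the chosen name of `N`. [cite: MochizukiFrdI2008, Prop. 5.5 (iv) p.104] -/
theorem repMapAt_eq {X Y : Pf h DivB} (r : PreFrobenioid.Perfection.Rep X Y) (N : ℕ+) (hX : X.idx * r.L.a = N)
    (hY : Y.idx * r.L.b = N) : repMapAt h hpf r N hX hY = repMap h hpf r := by
  subst hX
  rfl

/-- **Characterisation**: `stdRoot ≫ repMapAt θ = rootMap N (frob_A ≫ θ) ≫ rootLift(frob_B)⁻¹`.
[cite: MochizukiFrdI2008, Prop. 5.5 (iv) p.104] -/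
theorem stdRoot_repMapAt {X Y : Pf h DivB} (L : PreFrobenioid.Perfection.Level X Y) (θ : L.HomAt) (N : ℕ+)
    (hX : X.idx * L.a = N) (hY : Y.idx * L.b = N) :
    stdRoot DivBpf X.obj X.idx L.a N hX ≫ repMapAt h hpf ⟨L, θ⟩ N hX hY =
      rootMap (isCancelMul_of h) hpf N (PreFrobenioid.frob (h.isFrobenioid Φ B DivB) X.obj L.a ≫ θ) ≫
        (RLiso h hpf Y L.b N hY).inv := by
  unfold repMapAt
  rw [← Category.assoc, RLiso_hom, stdRoot_rootLift, ← Category.assoc, ← rootMap_comp]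

/-! ### Independence of the level -/

/-- The isomorphism at `B^{(b')}` splits along the transition arrow `B^{(b)} → B^{(b')}`:
`RL(frob_{b'}) = RL(frob_b) ≫ rootLift(frobTrans)`. [cite: MochizukiFrdI2008, Def. 3.1 (ii) p.56] -/
theorem RLiso_hom_trans (Y : Pf h DivB) {b b' : ℕ+} (hb : b ∣ b') (N t N' : ℕ+) (hN : Y.idx * b = N)
    (hN' : Y.idx * b' = N') (ht : degFr (PreFrobenioid.frobTrans (h.isFrobenioid Φ B DivB) Y.obj hb) = t)
    (hNt : N * t = N') :
    (RLiso h hpf Y b' N' hN').hom = (RLiso h hpf Y b N hN).hom ≫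
      rootLift (isCancelMul_of h) hpf (PreFrobenioid.frobTrans (h.isFrobenioid Φ B DivB) Y.obj hb)
        (PreFrobenioid.isFrobeniusType_frobTrans (h.isFrobenioid Φ B DivB) Y.obj hb) N t N' ht hNt := by
  have hbt : b * t = b' := by
    rw [← ht]; exact PreFrobenioid.degFr_frobTrans (h.isFrobenioid Φ B DivB) Y.obj hb
  have hcomp := PreFrobenioid.IsFrobeniusType.comp (toElem Φ B DivB) (h.isFrobenioid Φ B DivB)
    (PreFrobenioid.isFrobeniusType_frob (h.isFrobenioid Φ B DivB) Y.obj b)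
    (PreFrobenioid.isFrobeniusType_frobTrans (h.isFrobenioid Φ B DivB) Y.obj hb)
  have hdeg : degFr (PreFrobenioid.frob (h.isFrobenioid Φ B DivB) Y.obj b ≫
      PreFrobenioid.frobTrans (h.isFrobenioid Φ B DivB) Y.obj hb) = b' := by
    rw [degFr_comp, ht, ← hbt, mul_comm]
    exact congrArg (· * t) (PreFrobenioid.degFr_frob (h.isFrobenioid Φ B DivB) Y.obj b)
  rw [RLiso_hom, RLiso_hom, ← rootLift_comp (hφτ := hcomp) (haa := hbt) (hat := hdeg) (h'' := hN')]
  exact rootLift_congr (PreFrobenioid.frob_frobTrans (h.isFrobenioid Φ B DivB) Y.obj hb).symm _ _ _ _ _ _ _ _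

/-- **Transport invariance**: the image of a representative is unchanged under transport to a higher level
(along the transition arrows of Frobenius type `A^{(a)} → A^{(a')}`, `B^{(b)} → B^{(b')}`).
[cite: MochizukiFrdI2008, Def. 3.1 (ii) p.56] -/
theorem repMap_lift {X Y : Pf h DivB} (L L' : PreFrobenioid.Perfection.Level X Y) (hle : L.LE L') (φ : L.HomAt) :
    repMap h hpf ⟨L', PreFrobenioid.Perfection.Level.lift L L' hle φ⟩ = repMap h hpf ⟨L, φ⟩ := by
  -- degrees and indices
  obtain ⟨t, ht⟩ : ∃ t : ℕ+, degFr (PreFrobenioid.frobTrans (h.isFrobenioid Φ B DivB) X.obj hle.1) = t := ⟨_, rfl⟩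
  have hat : L.a * t = L'.a := by
    rw [← ht]; exact PreFrobenioid.degFr_frobTrans (h.isFrobenioid Φ B DivB) X.obj hle.1
  have hτYdeg : degFr (PreFrobenioid.frobTrans (h.isFrobenioid Φ B DivB) Y.obj hle.2) = t := by
    rw [← ht]; exact (PreFrobenioid.Perfection.Level.degFr_eq L L' hle).symm
  obtain ⟨N, hN⟩ : ∃ N : ℕ+, X.idx * L.a = N := ⟨_, rfl⟩
  obtain ⟨N', hN'⟩ : ∃ N' : ℕ+, X.idx * L'.a = N' := ⟨_, rfl⟩
  have hNt : N * t = N' := by rw [← hN, ← hN', mul_assoc, hat]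
  have hYN : Y.idx * L.b = N := by rw [← hN]; exact L.eq.symm
  have hYN' : Y.idx * L'.b = N' := by rw [← hN']; exact L'.eq.symm
  have hτY := PreFrobenioid.isFrobeniusType_frobTrans (h.isFrobenioid Φ B DivB) Y.obj hle.2
  haveI := isIso_rootLift (hΦc := isCancelMul_of h) (hpf := hpf) (isUnit_of h)
    (PreFrobenioid.frobTrans (h.isFrobenioid Φ B DivB) Y.obj hle.2) hτY N t N' hτYdeg hNt
  -- `RL(frob_{b'})⁻¹ = rootLift(frobTrans_Y)⁻¹ ≫ RL(frob_b)⁻¹`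
  have hsplit : RLiso h hpf Y L'.b N' hYN' = RLiso h hpf Y L.b N hYN ≪≫
      asIso (rootLift (isCancelMul_of h) hpf (PreFrobenioid.frobTrans (h.isFrobenioid Φ B DivB) Y.obj hle.2)
        hτY N t N' hτYdeg hNt) :=
    Iso.ext (RLiso_hom_trans h hpf Y hle.2 N t N' hYN hYN' hτYdeg hNt)
  -- `frob_{a'} ≫ lift φ = frob_a ≫ φ ≫ frobTrans_Y`
  have key : PreFrobenioid.frob (h.isFrobenioid Φ B DivB) X.obj L'.a ≫ PreFrobenioid.Perfection.Level.lift L L' hle φ =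
      (PreFrobenioid.frob (h.isFrobenioid Φ B DivB) X.obj L.a ≫ φ) ≫
        PreFrobenioid.frobTrans (h.isFrobenioid Φ B DivB) Y.obj hle.2 := by
    rw [← PreFrobenioid.frob_frobTrans (h.isFrobenioid Φ B DivB) X.obj hle.1, Category.assoc,
      PreFrobenioid.Perfection.Level.lift_spec, Category.assoc]
  -- compare after the epimorphism `stdRoot (N' → n)`
  rw [← repMapAt_eq h hpf ⟨L', _⟩ N' hN' hYN', ← repMapAt_eq h hpf ⟨L, φ⟩ N hN hYN]
  apply cancel_stdRoot X.obj X.idx L'.a N' hN'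
  rw [stdRoot_repMapAt, ← stdRoot_comp X.obj X.idx L.a N t N' L'.a hN hNt hat hN', Category.assoc, stdRoot_repMapAt,
    key, rootMap_comp, hsplit, Iso.trans_inv, asIso_inv, Category.assoc,
    ← stdRoot_rootLift (hΦc := isCancelMul_of h) (hpf := hpf)
      (PreFrobenioid.frobTrans (h.isFrobenioid Φ B DivB) Y.obj hle.2) hτY N t N' hτYdeg hNt,
    Category.assoc, IsIso.hom_inv_id_assoc, ← Category.assoc, stdRoot_naturality, Category.assoc]

/-- **Soundness**: agreeing representatives have the same image. [cite: MochizukiFrdI2008, Def. 3.1 (ii) p.56] -/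
theorem repMap_sound {X Y : Pf h DivB} {r s : PreFrobenioid.Perfection.Rep X Y}
    (hrs : PreFrobenioid.Perfection.Agree r s) : repMap h hpf r = repMap h hpf s := by
  obtain ⟨M, hr, hs, e⟩ := hrs
  obtain ⟨L, φ⟩ := r
  obtain ⟨L', ψ⟩ := s
  rw [← repMap_lift h hpf L M hr φ, ← repMap_lift h hpf L' M hs ψ]
  exact congrArg (fun θ => repMap h hpf ⟨M, θ⟩) e

/-! ### The functor `C^pf ⥤ C'` -/

/-- The comparison on morphisms (descended to the perfected morphisms). [cite: MochizukiFrdI2008, Prop. 5.5 (iv) p.104] -/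
def pfMap {X Y : Pf h DivB} : (X ⟶ Y) → (pfObj DivBpf h X ⟶ pfObj DivBpf h Y) :=
  Quotient.lift (repMap h hpf) fun _ _ hrs => repMap_sound h hpf hrs

/-- `pfMap` on the class of a representative. [cite: MochizukiFrdI2008, Prop. 5.5 (iv) p.104] -/
theorem pfMap_mk {X Y : Pf h DivB} (r : PreFrobenioid.Perfection.Rep X Y) :
    pfMap h hpf (PreFrobenioid.Perfection.Hom.mk r) = repMap h hpf r := rfl

/-- `pfMap` preserves identities. [cite: MochizukiFrdI2008, Prop. 5.5 (iv) p.104] -/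
theorem pfMap_id (X : Pf h DivB) : pfMap h hpf (𝟙 X) = 𝟙 (pfObj DivBpf h X) := by
  rw [PreFrobenioid.Perfection.id_eq_mk, pfMap_mk,
    show PreFrobenioid.Perfection.Rep.id X = ⟨⟨1, 1, rfl⟩, 𝟙 _⟩ from rfl, repMap, repMapAt]
  change (RLiso h hpf X 1 (X.idx * 1) rfl).hom ≫ rootMap (isCancelMul_of h) hpf (X.idx * 1) (𝟙 _) ≫
    (RLiso h hpf X 1 (X.idx * 1) rfl).inv = _
  rw [rootMap_id, Category.id_comp, Iso.hom_inv_id]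

/-- `pfMap` preserves composition (composites are computed at a common triple level).
[cite: MochizukiFrdI2008, Def. 3.1 (iii) p.57] -/
theorem pfMap_comp {X Y Z : Pf h DivB} (f : X ⟶ Y) (g : Y ⟶ Z) :
    pfMap h hpf (f ≫ g) = pfMap h hpf f ≫ pfMap h hpf g := by
  obtain ⟨⟨Lr, θr⟩, rfl⟩ := PreFrobenioid.Perfection.Hom.mk_surjective f
  obtain ⟨⟨Ls, θs⟩, rfl⟩ := PreFrobenioid.Perfection.Hom.mk_surjective g
  rw [PreFrobenioid.Perfection.mk_comp_mk, pfMap_mk, pfMap_mk, pfMap_mk]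
  -- the composite representative lives at the canonical triple level `T`
  let T := PreFrobenioid.Perfection.Level₃.can (⟨Lr, θr⟩ : PreFrobenioid.Perfection.Rep X Y) ⟨Ls, θs⟩
  have hr : Lr.LE T.fst := PreFrobenioid.Perfection.Level₃.le_can_fst ⟨Lr, θr⟩ ⟨Ls, θs⟩
  have hs : Ls.LE T.snd := PreFrobenioid.Perfection.Level₃.le_can_snd ⟨Lr, θr⟩ ⟨Ls, θs⟩
  change repMap h hpf ⟨T.out, PreFrobenioid.Perfection.compAt T ⟨Lr, θr⟩ ⟨Ls, θs⟩ hr hs⟩ = _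
  rw [← repMap_lift h hpf Lr T.fst hr θr, ← repMap_lift h hpf Ls T.snd hs θs]
  obtain ⟨N, hN⟩ : ∃ N : ℕ+, X.idx * T.a = N := ⟨_, rfl⟩
  have hYN : Y.idx * T.b = N := by rw [← hN]; exact T.eq₁.symm
  have hZN : Z.idx * T.c = N := by rw [← hYN]; exact T.eq₂.symm
  rw [← repMapAt_eq h hpf ⟨T.fst, _⟩ N hN hYN, ← repMapAt_eq h hpf ⟨T.snd, _⟩ N hYN hZN,
    ← repMapAt_eq h hpf ⟨T.out, _⟩ N hN hZN]
  unfold repMapAt PreFrobenioid.Perfection.compAt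
  simp only [rootMap_comp, Category.assoc, Iso.inv_hom_id_assoc]

/-- **The comparison functor `C^pf ⥤ C'`** of Prop. 5.5 (iv) (for the model Frobenioid of `(Φ, B, Div_B)`).
[cite: MochizukiFrdI2008, Prop. 5.5 (iv) p.104] -/
def pfFunctor : Pf h DivB ⥤ ModelFrobenioid (perfectionFunctor Φ) (perfectionFunctor B) DivBpf where
  obj X := pfObj DivBpf h X
  map f := pfMap h hpf f
  map_id X := pfMap_id h hpf X
  map_comp f g := pfMap_comp h hpf f g

/-- `pfFunctor` on the class of a representative. [cite: MochizukiFrdI2008, Prop. 5.5 (iv) p.104] -/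
theorem pfFunctor_map_mk {X Y : Pf h DivB} (r : PreFrobenioid.Perfection.Rep X Y) :
    (pfFunctor h hpf).map (PreFrobenioid.Perfection.Hom.mk r) = repMap h hpf r := rfl

/-! ### Faithfulness -/

/-- Two arrows `θ₁, θ₂ : A^{(a)} → B^{(b)}` of `C` with the same image under `rootMap N` have the same class in
`C^pf`: their data agree up to torsion, which the Frobenius conjugation along `B^{(b)} → B^{(b t)}` kills.
[cite: MochizukiFrdI2008, Def. 3.1 (ii) p.56] -/
theorem mk_eq_mk_of_rootMap_eq {X Y : Pf h DivB} (L : PreFrobenioid.Perfection.Level X Y) (φ ψ : L.HomAt) (N : ℕ+)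
    (hφψ : rootMap (isCancelMul_of h) hpf N φ = rootMap (isCancelMul_of h) hpf N ψ) :
    PreFrobenioid.Perfection.Hom.mk ⟨L, φ⟩ = PreFrobenioid.Perfection.Hom.mk ⟨L, ψ⟩ := by
  have hd := congrArg degFr hφψ
  have hb := congrArg baseMap hφψ
  have hv := congrArg div hφψ
  have hu := congrArg unit hφψ
  rw [degFr_rootMap, degFr_rootMap] at hd
  rw [baseMap_rootMap, baseMap_rootMap] at hb
  rw [div_rootMap, div_rootMap] at hv
  rw [unit_rootMap, unit_rootMap] at hu
  have hv' : Perfection.of _ (div φ) = Perfection.of _ (div ψ) := by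
    rw [← Perfection.root_pow N (Perfection.of _ (div φ)), hv, Perfection.root_pow]
  have hu' : Perfection.of _ (unit φ) = Perfection.of _ (unit ψ) := by
    rw [← Perfection.root_pow N (Perfection.of _ (unit φ)), hu, Perfection.root_pow]
  obtain ⟨K₁, hK₁⟩ := Perfection.of_eq_of_iff.mp hv'
  obtain ⟨K₂, hK₂⟩ := Perfection.of_eq_of_iff.mp hu'
  -- the conjugating arrow of Frobenius type of degree `t = K₁ K₂` out of `B^{(b)}`
  have hdiv : div φ ^ ((K₁ * K₂ : ℕ+) : ℕ) = div ψ ^ ((K₁ * K₂ : ℕ+) : ℕ) := by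
    rw [PNat.mul_coe, pow_mul, pow_mul, hK₁]
  have hunit : unit φ ^ ((K₁ * K₂ : ℕ+) : ℕ) = unit ψ ^ ((K₁ * K₂ : ℕ+) : ℕ) := by
    rw [PNat.mul_coe, mul_comm, pow_mul, pow_mul, hK₂]
  let L' : PreFrobenioid.Perfection.Level X Y :=
    ⟨L.a * (K₁ * K₂), L.b * (K₁ * K₂), by rw [← mul_assoc, L.eq, mul_assoc]⟩
  have hle : L.LE L' := ⟨Dvd.intro _ rfl, Dvd.intro _ rfl⟩
  have hτ := PreFrobenioid.isFrobeniusType_frobTrans (h.isFrobenioid Φ B DivB) Y.obj hle.2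
  have hdegτ : degFr (PreFrobenioid.frobTrans (h.isFrobenioid Φ B DivB) Y.obj hle.2) = K₁ * K₂ :=
    mul_left_cancel (PreFrobenioid.degFr_frobTrans (h.isFrobenioid Φ B DivB) Y.obj hle.2)
  have hdivτ : div (PreFrobenioid.frobTrans (h.isFrobenioid Φ B DivB) Y.obj hle.2) = 1 := hτ.1.2
  have hconj : φ ≫ PreFrobenioid.frobTrans (h.isFrobenioid Φ B DivB) Y.obj hle.2 =
      ψ ≫ PreFrobenioid.frobTrans (h.isFrobenioid Φ B DivB) Y.obj hle.2 := by
    refine hom_ext ?_ ?_ ?_ ?_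
    · rw [degFr_comp, degFr_comp, hd]
    · rw [baseMap_comp, baseMap_comp, hb]
    · rw [div_comp, div_comp, hb, hdegτ, hdiv]
    · rw [unit_comp, unit_comp, hb, hdegτ, hunit]
  -- so the transports to the level `(a t, b t)` coincide
  refine PreFrobenioid.Perfection.Hom.mk_eq_mk.mpr ⟨L', hle, hle, ?_⟩
  change PreFrobenioid.Perfection.Level.lift L L' hle φ = PreFrobenioid.Perfection.Level.lift L L' hle ψ
  refine PreFrobenioid.Perfection.Level.lift_unique L L' hle ?_
  rw [PreFrobenioid.Perfection.Level.lift_spec, hconj]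

/-- **`pfFunctor` is faithful.** [cite: MochizukiFrdI2008, Prop. 5.5 (iv) p.104] -/
theorem pfFunctor_faithful : (pfFunctor h hpf).Faithful := by
  refine ⟨fun {X Y} f g hfg => ?_⟩
  obtain ⟨⟨Lr, θr⟩, rfl⟩ := PreFrobenioid.Perfection.Hom.mk_surjective f
  obtain ⟨⟨Ls, θs⟩, rfl⟩ := PreFrobenioid.Perfection.Hom.mk_surjective g
  rw [pfFunctor_map_mk, pfFunctor_map_mk] at hfg
  -- transport both to the common level `M`
  let M := Lr.sup Ls
  have hr : Lr.LE M := PreFrobenioid.Perfection.Level.le_sup_left _ _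
  have hs : Ls.LE M := PreFrobenioid.Perfection.Level.le_sup_right _ _
  rw [← PreFrobenioid.Perfection.Hom.mk_lift ⟨Lr, θr⟩ M hr, ← PreFrobenioid.Perfection.Hom.mk_lift ⟨Ls, θs⟩ M hs]
  rw [← repMap_lift h hpf Lr M hr θr, ← repMap_lift h hpf Ls M hs θs] at hfg
  apply mk_eq_mk_of_rootMap_eq h hpf M _ _ (X.idx * M.a)
  unfold repMap repMapAt at hfg
  exact (Iso.cancel_iso_inv_right _ _ _).mp ((Iso.cancel_iso_hom_left _ _ _).mp hfg)

/-! ### Essential surjectivity -/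

/-- **`pfFunctor` is essentially surjective**: `(A_D, γ)` with `γ = ι_N^gp(c)` is `pfObj ((A_D, c), N)`.
[cite: MochizukiFrdI2008, Prop. 5.5 (iv) p.104] -/
theorem pfFunctor_essSurj : (pfFunctor h hpf).EssSurj := by
  refine ⟨fun W => ?_⟩
  obtain ⟨Wb, Wc⟩ := W
  obtain ⟨N, c, hc⟩ := exists_gpApp_toPerfectionRoot_eq (Φ := Φ) (op Wb) Wc
  refine ⟨⟨⟨Wb, c⟩, N⟩, ⟨eqToIso ?_⟩⟩
  change (⟨Wb, gpApp (toPerfectionRoot Φ N) (op Wb) c⟩ : ModelFrobenioid _ _ DivBpf) = ⟨Wb, Wc⟩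
  rw [hc]

/-! ### Compatibility with `Base` -/

/-- `Base` of the image of a representative is abc-iut-L1-d9's `Rep.baseMap`:
`Base(frob_A) ≫ Base(θ) ≫ Base(frob_B)⁻¹`. [cite: MochizukiFrdI2008, Prop. 3.2 (i) p.58] -/
theorem baseMap_repMap {X Y : Pf h DivB} (r : PreFrobenioid.Perfection.Rep X Y) :
    baseMap (repMap h hpf r) = PreFrobenioid.Perfection.Rep.baseMap r := by
  have e : baseMap (RLiso h hpf Y r.L.b (X.idx * r.L.a) r.L.eq.symm).hom ≫
      baseMap (RLiso h hpf Y r.L.b (X.idx * r.L.a) r.L.eq.symm).inv = 𝟙 _ := by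
    rw [← baseMap_comp, Iso.hom_inv_id]
    rfl
  have hinv : PreFrobenioid.baseInvFrob (h.isFrobenioid Φ B DivB) Y.obj r.L.b =
      baseMap (RLiso h hpf Y r.L.b (X.idx * r.L.a) r.L.eq.symm).inv :=
    @IsIso.inv_eq_of_hom_inv_id _ _ _ _ _
      (PreFrobenioid.isIso_base_frob (h.isFrobenioid Φ B DivB) Y.obj r.L.b) _ e
  unfold repMap repMapAt PreFrobenioid.Perfection.Rep.baseMap
  rw [baseMap_comp, baseMap_comp, ← hinv]
  rfl

/-- **`pfFunctor ⋙ Base ≅ Base`**: the comparison functor lies over `D` (on objects on the nose; on arrows by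
`baseMap_repMap`). [cite: MochizukiFrdI2008, Prop. 5.5 (iv) p.104] -/
def pfFunctorCompBaseIso :
    pfFunctor h hpf ⋙ baseFunctor (perfectionFunctor Φ) (perfectionFunctor B) DivBpf ≅
      (PreFrobenioid.Perfection.ops (h.isFrobenioid Φ B DivB)).base :=
  NatIso.ofComponents (fun _ => Iso.refl _) (fun {X Y} f => by
    obtain ⟨r, rfl⟩ := PreFrobenioid.Perfection.Hom.mk_surjective f
    exact (Category.comp_id _).trans ((baseMap_repMap h hpf r).trans (Category.id_comp _).symm))

end PfCompare

end ModelFrobenioid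

end Literature.AlgebraicGeometry.Frobenioids

end
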